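/-
Copyright (c) 2026 the pub-hodgecm-mathlib formalisation cell (harness21).  Prover seat hodgecm-mathlib-K2E1-p11 (g2), Track B ∕ K2-LIT, h413 =
`stmt-HodgeConjecture-24833`, line `K2_E1_TraceFormulaBeta`, 5Res campaign «ENDGAME BY FAMILIES» ∕ ROADCARD §3′ (M2 v2), deals (255)(y1) ∕ (272)/2: the SELF-DUAL `hU` on
`U(1,1)_{L∕L⁺}` — ★ (y1-c) `hU_selfDual_of_generators` instantiated on the χ-section pseudo-Eisenstein family of a self-dual block: generator relations from ★ B1 (automorphic side) and
★ FILE A (Mellin multiplier), the symbol bounded on the axis (★ B2 §1); the ONE visible letter is the axis Weyl symmetry `hsymm` (ruling (261): FE road ★ `symbol_weylSymm`, or a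
χ-twisted (G1) — this seat's (272) census: the plain ★ `sphericalTransform_symm_cm_two` pays it only for `χ∘β ≡ 1`).
-/
import Summits.HodgeConjecture.HodgeConjecture.Theorems.K2E1SelfDualModelHeckeIntertwining        -- ★ (y1-c) p860878 (this seat): `hU_selfDual_of_generators`; brings ★ B2/B1/FILE A, ★ (y1-b) `_sqrt` head
import HarnessLib

/-!
# (y1)∕(272)/2 — `K2E1ChiSectionHeckeIntertwiningSelfDualCMTwo`: `U R(η) = (diag s(z_c) ⊕ M_{s(½+i·)}) U` on a self-dual χ-block of `U(1,1)_{L∕L⁺}` (letter `hsymm`)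

Cell `pub/hodgecm-mathlib`, crux H413 = `stmt-HodgeConjecture-24833`, route `HCCMUnconditional`; dealer K2E1-plan (g7) (255)(y1), (257), (261), (272).  THEOREMS ONLY (no `def` ∕ `instance` ∕
`notation` ∕ named-fact hypothesis ∕ `sorry`); lane `--kind proof --supports stmt-HodgeConjecture-24833 --as helper` (count-neutral; closes no socket).
INPUT SHAPE.  The self-dual model data `(T, r, w, Uiso)` with the three clauses `hr_apply ∕ hw ∕ hU` are EXACTLY the conclusion bytes of ★ K2E4-p10's
`exists_linearIsometry_chiSection_selfDual_cm_two_sqrt` (p860798) with `W := span {v_a}`, `vA a := ⟨v a, _⟩` (kept ABSTRACT here: the submodule instance chain is too slow to elaborate in one declaration) — the consumer destructures it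
`⟨T, r, w, Uiso, _, _, _, hr_apply, _, hw, hU⟩` and passes the four; the generators are
`x_i = Σ_a y_{i,a}` with `y_{i,a} =ᵐ θ_{f_{i,a},φ_a}` (`hy`) and the family is closed under the smoothing profile of `η` (`τ`, `hfτ`, `hyτ` — ★ FILE A's `g`).
THE MATHEMATICS ([MoeglinWaldspurger1995, II.2.4, IV.3.12]).  `R(η) y_{i,a} = y_{τ i,a}` in `L²(X)` (★ B1 `integratedOperator_eq_of_ae_eq_radialSection_cm_two`); `mellin f_{τ i,a} = s(−·)·mellin f_{i,a}`
(★ FILE A `mellin_smoothingProfile`); `‖s(½+it)‖ ≤ B` (★ B2 `norm_symbol_axis_le`) so `σ = s(½+i·) ∈ L^∞((0,∞))`; with `hsymm` ★ (y1-c) gives `R(η)(Θ) ⊆ Θ` and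
**`Uiso(R(η) v) = ((s(c)•(Uiso v)_c)_{c∈S}, σ•(Uiso v)_cont)`** for every `v ∈ Θ`.  All-of-`H`: ★ (y2) `modelMap_map_eq_of_on_closedSpan` with ★ (y1-c) `exists_prodMultiplier` and `hadjΘ` ★ `hadjΘ_of_symm`.
* §1 `memLp_top_axis`.  * §2 **`hU_selfDual_cm_two`**.
HONEST LABEL.  Count-neutral helper; proves no printed statement; letter-free except ★ P1's `hact`, the model data (★ p860798), the representatives `hy ∕ hyτ ∕ hfτ`, and **`hsymm`**.  HC_CM is
proved only modulo the 7 printed citations (2 remaining named inputs: hLiu418 = `stmt-HodgeConjecture-24832`, h413 = `stmt-HodgeConjecture-24833`) until rung 0 closes.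

## References
* [MoeglinWaldspurger1995] C. Mœglin, J.-L. Waldspurger, *Spectral decomposition and Eisenstein series* (1995), II.2.4, IV.3.12.
-/

set_option autoImplicit false
-- the mandated namespace repeats `HodgeConjecture.HodgeConjecture`, as in every `Theorems/*.lean` of this sub-problem
set_option linter.dupNamespace false

noncomputable section

open MeasureTheory MeasureTheory.Measure Set Filter Topology Complex NumberField CompactlySupported Submodule
open scoped NNReal ENNReal Real
open Literature.NumberTheory.Automorphic Literature.NumberTheory.Automorphic.UnitaryGroup AdelicGroupData ContRepresentation
open Literature.NumberTheory.GaloisRepresentations (HeckeCharacter)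
open Summit.HodgeConjecture.HodgeConjecture.Cruxes.H413.K2E1BorelEisensteinU
open Summit.HodgeConjecture.HodgeConjecture.Cruxes.H413.K2E1CharacterEisensteinU2Defs
open Summit.HodgeConjecture.HodgeConjecture.Cruxes.H413.K2E1PlancherelIsometryOfForm (mem_topologicalClosure_span)
open Summit.HodgeConjecture.HodgeConjecture.Cruxes.H413.K2E1ChiSectionSmoothingProfileU2 (mellin_smoothingProfile)
open Summit.HodgeConjecture.HodgeConjecture.Cruxes.H413.K2E1ChiSectionHeckeStableCMTwo (integratedOperator_eq_of_ae_eq_radialSection_cm_two)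
open Summit.HodgeConjecture.HodgeConjecture.Cruxes.H413.K2E1ChiSectionHeckeIntertwiningCMTwo (norm_symbol_axis_le)
open Summit.HodgeConjecture.HodgeConjecture.Cruxes.H413.K2E1SelfDualModelHeckeIntertwining (hU_selfDual_of_generators)

namespace Summit.HodgeConjecture.HodgeConjecture.Cruxes.H413.K2E1ChiSectionHeckeIntertwiningSelfDualCMTwo

/-! ## §1 The symbol on the axis is in `L^∞` -/

/-- A continuous symbol bounded on the unitary axis gives `t ↦ s(½+it) ∈ L^∞(m)` for any measure `m` on `ℝ`. [cite: MoeglinWaldspurger1995, II.2.4] -/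
theorem memLp_top_axis {s : ℂ → ℂ} (m : Measure ℝ) (hsc : Continuous s) {B : ℝ} (hB : ∀ y : ℝ, ‖s ((((1 / 2 : ℝ)) : ℂ) + y * I)‖ ≤ B) :
    MemLp (fun t : ℝ => s ((((1 / 2 : ℝ)) : ℂ) + t * I)) ∞ m := by
  have hc : Continuous fun t : ℝ => s ((((1 / 2 : ℝ)) : ℂ) + t * I) := hsc.comp (by fun_prop)
  exact memLp_top_of_bound hc.aestronglyMeasurable B (Eventually.of_forall hB)

/-! ## §2 The self-dual `hU` on `U(1,1)_{L∕L⁺}` -/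

section Two

variable (L : Type) [Field L] [NumberField L] [IsCMField L]
variable [MeasurableSpace (quasiSplit (↥(maximalRealSubfield L)) L (IsCMField.complexConj L) 2).Adelic] [BorelSpace (quasiSplit (↥(maximalRealSubfield L)) L (IsCMField.complexConj L) 2).Adelic]

/-- **THE SELF-DUAL `hU` ON `U(1,1)_{L∕L⁺}`** (letter `hsymm`): for a χ-section pseudo-Eisenstein family `x_i = Σ_a [θ_{f_{i,a},φ_a}]` of a self-dual block, closed under the smoothing profile
of the `K_∞`-central pure tensor `η` (★ P1 symbol `s`), with K2E4-p10's ★ `_sqrt` self-dual model data stated over an abstract finite-dimensional `W` (instantiate `W := span {v_a}`,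
`vA a := ⟨v a, _⟩`): `σ = s(½+i·) ∈ L^∞` and, for every `v ∈ Θ`, `R(η) v ∈ Θ` and
**`Uiso(R(η) v) = ((s(c) • (Uiso v)_c)_{c∈S}, σ • (Uiso v)_cont)`**. [cite: MoeglinWaldspurger1995, II.2.4, IV.3.12] -/
theorem hU_selfDual_cm_two [ENNReal.HolderTriple ∞ 2 2]
    [LocallyCompactSpace (quasiSplit (↥(maximalRealSubfield L)) L (IsCMField.complexConj L) 2).Adelic] [SecondCountableTopology (quasiSplit (↥(maximalRealSubfield L)) L (IsCMField.complexConj L) 2).Adelic]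
    (μ : Measure (quasiSplit (↥(maximalRealSubfield L)) L (IsCMField.complexConj L) 2).automorphicQuotient) [(quasiSplit (↥(maximalRealSubfield L)) L (IsCMField.complexConj L) 2).IsAutomorphicMeasure μ]
    (νG : Measure (quasiSplit (↥(maximalRealSubfield L)) L (IsCMField.complexConj L) 2).Adelic) [νG.IsHaarMeasure] [SFinite νG]
    (η : C_c((quasiSplit (↥(maximalRealSubfield L)) L (IsCMField.complexConj L) 2).Adelic, ℂ)) {χ : HeckeCharacter L}
    {ι α : Type*} [Fintype α] [Nonempty α] {φ : α → (quasiSplit (↥(maximalRealSubfield L)) L (IsCMField.complexConj L) 2).Adelic → ℂ}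
    (hφ : ∀ a, IsChiSection χ (φ a)) (hφc : ∀ a, Continuous (φ a)) (Mφ : α → ℝ) (hφM : ∀ a x, ‖φ a x‖ ≤ Mφ a)
    (k₀ : α → (quasiSplit (↥(maximalRealSubfield L)) L (IsCMField.complexConj L) 2).Adelic) (hk₀ : ∀ a, adelicVal (↥(maximalRealSubfield L)) L (IsCMField.complexConj L) 2 ((StdForm.antidiagonal 2).over L) (k₀ a) ∈ standardMaximalCompactGL 2 L)
    (hx₀ : ∀ a, φ a (k₀ a) ≠ 0)
    {f : ι → α → ℝ → ℂ} (hf : ∀ i a, ContDiff ℝ 2 (f i a)) (hfs : ∀ i a, HasCompactSupport (f i a)) (hf0 : ∀ i a, tsupport (f i a) ⊆ Ioi 0)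
    {s : ℂ → ℂ} (hsc : Continuous s)
    (hact : ∀ (a : α) (z : ℂ) (x : (quasiSplit (↥(maximalRealSubfield L)) L (IsCMField.complexConj L) 2).Adelic), ∫ y, η y * flatSectionU (φ a) z (x * y) ∂νG = s z * flatSectionU (φ a) z x)
    (hsymm : ∀ t : ℝ, s ((((1 / 2 : ℝ)) : ℂ) + ((-t : ℝ) : ℂ) * I) = s ((((1 / 2 : ℝ)) : ℂ) + t * I))
    -- the generators and their τ-closure under the smoothing profile
    (y : ι → α → Lp ℂ 2 μ)
    (hy : ∀ i a, (y i a : (quasiSplit (↥(maximalRealSubfield L)) L (IsCMField.complexConj L) 2).automorphicQuotient → ℂ) =ᵐ[μ]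
      (quasiSplit (↥(maximalRealSubfield L)) L (IsCMField.complexConj L) 2).quotFun (eisensteinSeriesU (fun g : (quasiSplit (↥(maximalRealSubfield L)) L (IsCMField.complexConj L) 2).Adelic => f i a (borelHeight g : ℝ) * φ a g)))
    (τ : ι → ι)
    (hfτ : ∀ i a, f (τ i) a = fun r : ℝ => ∫ w, f i a (r * (borelHeight w : ℝ)) * (η ((k₀ a)⁻¹ * w) * (φ a w / φ a (k₀ a))) ∂νG)
    (hyτ : ∀ i a, (y (τ i) a : (quasiSplit (↥(maximalRealSubfield L)) L (IsCMField.complexConj L) 2).automorphicQuotient → ℂ) =ᵐ[μ]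
      (quasiSplit (↥(maximalRealSubfield L)) L (IsCMField.complexConj L) 2).quotFun (eisensteinSeriesU (fun g : (quasiSplit (↥(maximalRealSubfield L)) L (IsCMField.complexConj L) 2).Adelic =>
        (fun r : ℝ => ∫ w, f i a (r * (borelHeight w : ℝ)) * (η ((k₀ a)⁻¹ * w) * (φ a w / φ a (k₀ a))) ∂νG) (borelHeight g : ℝ) * φ a g)))
    -- the self-dual model data (★ `exists_linearIsometry_chiSection_selfDual_cm_two_sqrt`, destructured)
    {W : Type*} [NormedAddCommGroup W] [InnerProductSpace ℂ W] [FiniteDimensional ℂ W] (vA : α → W)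
    (M : ℂ → W →ₗ[ℂ] W) (S : Finset ℝ) {C : ℝ}
    (T : ↥S → W →L[ℂ] W)
    (r : ι → PiLp 2 (fun _ : ↥S => W)) (w : ι → Lp W 2 ((volume : Measure ℝ).restrict (Ioi 0)))
    (Uiso : (span ℂ (Set.range fun i => ∑ a, y i a)).topologicalClosure →ₗᵢ[ℂ]
      WithLp 2 (PiLp 2 (fun _ : ↥S => W) × Lp W 2 ((volume : Measure ℝ).restrict (Ioi 0))))
    (hr_apply : ∀ i (c : ↥S), r i c = ((Real.sqrt C : ℝ) : ℂ) • T c (∑ a, mellin (f i a) (-((c : ℝ) : ℂ)) • vA a))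
    (hw : ∀ i, (w i : ℝ → W) =ᵐ[(volume : Measure ℝ).restrict (Ioi 0)] fun t =>
      (∑ a, mellin (f i a) (-((((1 / 2 : ℝ)) : ℂ) + t * I)) • vA a) +
        M ((((1 / 2 : ℝ)) : ℂ) + ((-t : ℝ) : ℂ) * I) (∑ a, mellin (f i a) (-((((1 / 2 : ℝ)) : ℂ) + ((-t : ℝ) : ℂ) * I)) • vA a))
    (hU : ∀ i, Uiso ⟨∑ a, y i a, mem_topologicalClosure_span (fun i => ∑ a, y i a) i⟩ = WithLp.toLp 2 (r i, ((Real.sqrt (C * (2 * π)⁻¹) : ℝ) : ℂ) • w i)) :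
    ∃ hσ : MemLp (fun t : ℝ => s ((((1 / 2 : ℝ)) : ℂ) + t * I)) ∞ ((volume : Measure ℝ).restrict (Ioi 0)),
      ∀ (x₀ : Lp ℂ 2 μ) (hv : x₀ ∈ (span ℂ (Set.range fun i => ∑ a, y i a)).topologicalClosure),
        ∃ hRv : ((quasiSplit (↥(maximalRealSubfield L)) L (IsCMField.complexConj L) 2).rightRegular μ).integratedOperator ((quasiSplit (↥(maximalRealSubfield L)) L (IsCMField.complexConj L) 2).isUnitary_rightRegular μ) ((quasiSplit (↥(maximalRealSubfield L)) L (IsCMField.complexConj L) 2).isStronglyContinuous_rightRegular_holds μ) νG η x₀ ∈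
            (span ℂ (Set.range fun i => ∑ a, y i a)).topologicalClosure,
          Uiso ⟨_, hRv⟩ = WithLp.toLp 2 (WithLp.toLp 2 (fun c : ↥S => s ((c : ℝ) : ℂ) • (Uiso ⟨x₀, hv⟩).fst c),
            (hσ.toLp _ : Lp ℂ ∞ ((volume : Measure ℝ).restrict (Ioi 0))) • (Uiso ⟨x₀, hv⟩).snd) := by
  obtain ⟨a₀⟩ := ‹Nonempty α›
  have hB := norm_symbol_axis_le νG (hk₀ a₀) (hx₀ a₀) (fun z => hact a₀ z (k₀ a₀))
  have hσ : MemLp (fun t : ℝ => s ((((1 / 2 : ℝ)) : ℂ) + t * I)) ∞ ((volume : Measure ℝ).restrict (Ioi 0)) := memLp_top_axis _ hsc hB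
  have hRy : ∀ i a, ((quasiSplit (↥(maximalRealSubfield L)) L (IsCMField.complexConj L) 2).rightRegular μ).integratedOperator ((quasiSplit (↥(maximalRealSubfield L)) L (IsCMField.complexConj L) 2).isUnitary_rightRegular μ) ((quasiSplit (↥(maximalRealSubfield L)) L (IsCMField.complexConj L) 2).isStronglyContinuous_rightRegular_holds μ) νG η (y i a) = y (τ i) a :=
    fun i a => integratedOperator_eq_of_ae_eq_radialSection_cm_two L μ νG η (hφ a) (hφc a) (hφM a) (hk₀ a) (hx₀ a) (hact a) (hf i a) (hfs i a) (hf0 i a) (y i a) (y (τ i) a) (hy i a) (hyτ i a)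
  have hmel : ∀ i a z, mellin (f (τ i) a) z = s (-z) * mellin (f i a) z := fun i a z => by
    rw [hfτ i a]
    exact mellin_smoothingProfile νG η.continuous η.hasCompactSupport (hφc a) (hk₀ a) (hx₀ a) (fun z => hact a z (k₀ a)) (hf i a).continuous (hfs i a) (hf0 i a) z
  exact ⟨hσ, fun x₀ hv => hU_selfDual_of_generators vA y M S T r w Uiso hr_apply hw hU _ τ hRy hmel hsymm hσ x₀ hv⟩

end Two

end Summit.HodgeConjecture.HodgeConjecture.Cruxes.H413.K2E1ChiSectionHeckeIntertwiningSelfDualCMTwo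

end
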